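import Summits.QuantumFields.BalabanUV.T4Continuum.Spine.NE1p.DressedSmallFieldMixedLetter

/-!
# T⁴ programme, spine estimate NE1′ (node O3b/H2) — WITNESS: THE MIXED CUBE LETTER, part 2: N0k's END FIRES on W23's two-cube catalogue with
# the (2.38)-shape socket `hL3` DERIVED for EVERY JOINTLY entire table-free factor bounded by `1` on the closed polydisc `|σ(Δ)| ≤ e^{κ₁}` —
# W34's product hypothesis removed; GENUINE on a decided NON-product factor

Cell `pub-balaban`, sub-cell `t4`, row NE1′ formalisation crew (`t4/formal/NE1p/LEAVES.md` row W39 part 2 = W39.2 ∕ DAG N29zv; own-initiative witness under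
typer R-T61 (ii), INTENT journal l.17565, BOOKED R-T115 (iii) l.17757; part 1 = W39.1 `DressedSmallFieldMixedLetter`; X-read X137), unit
`b2b-balaban-t4-ne1p-formalise-leaf-08` (gen 10).  ADDITIVE — imports part 1 `Spine/NE1p/DressedSmallFieldMixedLetter` ONLY
(through it W34 `DressedSmallFieldCubeLetterWitness` — `μc`, `νK`, `cK`, `linK`, `hlinw_K`, `hl_K`, `card_cubes₂` BY NAME —, W29
`DressedSmallFieldContourWitness` — `cauchyLetter_rep`, `ev`, `V₀M`, `OM`, `oR`, the table norms BY NAME —, the NE5 substrate `Support/B13TermContours`,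
owner node N0k `DressedSmallFieldShape` (p220184), W23's catalogue (p221160), W25 (p222160)); toy DATA `def`s + theorems; 0 `def … : Prop`, 0 cite,
0 sorry; nothing of N0k ∕ W23 ∕ W25 ∕ W29 ∕ W34 ∕ the substrate restated.

WHAT THIS FILE DOES.
* §3 ONE (2.14)-SHAPE TERM PER POLYMER `Z` OF W23's CATALOGUE WITH A JOINT FACTOR `F Z : (Fin 2 → ℂ) → ℂ` of the cube variables of `Z`
  (admissibility: `hF` jointly entire, `hB` bounded by `1` on the closed POLYDISC `|σ(Δ)| ≤ e^{κ₁}` — print's (1.18)∕(1.21) on the analyticity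
  domain `|s(Δ)| ≤ e^{κ₁}`, TYPE): on W34's parameter space and term measure `νK Z` (cube letters `p`, polymer letter `q`), prefactor
  `preF = cK·wS(e^{κ₁})(cubes₂ Z)(p)·F Z(σS(p))·w₁ 2 q`, functional W34's `linK` (W29's Mayer letter), W34's d-FREE `cK = 1∕(24e^{1∕2})`;
  the RADIUS-FREE activity `actF F s Z = cK·Δ_{cubes₂ Z}(F Z)·(e^{(V₀M + s•OM) Z} − 1)`; **`hrep_F`: (B1) a THEOREM at every radius `κ₁ > 0`**
  (Fubini × part 1 `mixedLetter_rep` × W29 `cauchyLetter_rep`); sockets `hpre_F`∕`hint_F`; **`hL3_F` DERIVED for all `κ₁ ≥ 1` and all admissible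
  `F`: `≤ (1∕12)·e^{−(κ₁−1)·d₂ Z}`** (part 1 `mixedLetter_decay_le`, `#cubes₂ Z = d₂ Z + 1`, polymer letter `2e^{1∕2}`); **`muPart_fires_F`: N0k
  `muPart_locE_le_of_linearDressing` ONCE BY NAME for all `κ₁ ≥ 6`** (`hrate : 1 + 2·1 + 2 ≤ κ₁ − 1` as located in W34), W23's sockets and
  `envelope₂_eq` BY NAME: `‖E_μ(univ) − E_0(univ)‖ ≤ (3∕16)·μ₀∕(1 − μ₀)`.
* §4 GENUINE on the DECIDED NON-PRODUCT factor `Fj κ₁ Z σ = (1 + e^{−κ₁·#cubes₂ Z}·Π_{Δ∈cubes₂ Z} σ Δ)∕2`: jointly entire, `‖Fj‖ ≤ 1` on the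
  polydisc (`norm_Fj_le`) and `= 1` at `σ ≡ e^{κ₁}` (`Fj_diag` — `hB` TIGHT); **`Fj_not_product`: on the pair polymer `Fj` is NOT of W34's form
  `g(σ₀)·h(σ₁)`**; `mixedDiff_Fj : Δ_{cubes₂ Z}(Fj κ₁ Z) = e^{−κ₁·#cubes₂ Z}∕2` (a genuinely mixed second difference on the pair); the END in
  closed numerals (`muPart_fires_Fj`) and **the μ-part is NOT zero** (`locE_live_Fj`, W25 `exp_locE_univ` BY NAME).

HONEST FRAMING (typer R-T115 (iii)(g): the INTENT's HONEST sentence + rider, verbatim in substance).  TYPER RIDER (R-T115 (iii)(g), verbatim): «`mixedDiff` ∕ `μS` ∕ `wS` ∕ `σS` are OUR dictionary on the substrate's (row NE5) contour SPACE, EQUAL to `lamJ` ∕ `wJ` ∕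
`sigmaJ` at `S = univ` BY THEOREM; the polydisc bound `hB` is the toy's HYPOTHESIS carrying print's (1.18)∕(1.21) TYPE — not a bound proved for Bałaban's
operators; `Fj` is OUR decided non-product factor; κ₁ ≥ 1 ∕ κ₁ ≥ 6 are OUR thresholds on OUR majorants and W23's numerals — no numeral of [Balaban1988RGII];
(B1)∕(B3) for (2.14) NOT discharged».  ONE printed MECHANISM of [Balaban1988RGII] (2.15) — JOINTLY analytic & bounded by `1` on the closed polydisc ⇒ decay
`e^{−(κ₁−1)}` per cube — exercised IN KERNEL on the NE5 substrate's CONTOUR OBJECTS over W23's decided two-cube catalogue, for the CLASS of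
jointly entire table-free factors ([folklore] analysis through part 1's dictionary; Fubini on `Measure.pi`∕`Measure.prod`; located real
arithmetic); the polydisc bound is the toy's HYPOTHESIS `hB` (print's (1.18)∕(1.21) TYPE); the identification of `F Z` with print's s(Δ)-dependent
operator products ((1.10)∕(2.7), `H_k(s(Y₀),B′)`, the characteristic functions) and of `e^{κ₁}` with (1.22)∕(1.23)'s circle is a TYPE READING;
the thresholds `κ₁ ≥ 1` ∕ `κ₁ ≥ 6` are OUR arithmetic on OUR majorant shapes and W23's numerals — no numeral of print asserted (k2); (B1) for
Bałaban's (2.14) NOT discharged; (B3) for Bałaban's tables = GAPS G-ne9p2-5 UNPRINTED (shared with row NE9) — NOT discharged, untouched; (B5)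
untouched; 0 binders instantiated on Bałaban's densities ∕ operators ∕ (2.14) data ∕ `d_k` ∕ minimisers ∕ backgrounds; discharges no wall item;
wall v1.7 (T4-DAG v42) does NOT move; R-t4r2-Q2 NOT met thereby; NE1′ ⇐ the named binders — NOT proved, NOT printed; spine PROVED 0∕9; count 9
unchanged.  Rung (B)+1 on ONE finite four-torus — NOT infinite volume, NOT a mass gap, NOT OS on ℝ⁴, NOT Clay.  ABSOLUTE RULE honoured: the
quotations are LOCI of the audited manuscript [Balaban1988RGII] (CMP 116 (1988) 1–22, pp. 6, 7, 14, 15), TYPE∕CONTEXT only, never hypothesis-free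
facts; nothing internally minted is cited; [folklore]∕[arith] tags on kernel lemmas only.  HONEST DEPENDENCY: continuum YM on T⁴ ⇐ BetaPertH ∧
nine spine estimates (0/9 proved); BetaPertH ⇐ (D1) ∧ (D4) ∧ CAP+tail; G-an2-4 gates asym, D1 and NE2/3/4.
-/

noncomputable section

namespace Summit.QuantumFields.BalabanUV.T4Continuum.NE1p.DressedSmallFieldMixedLetterWitness

open MeasureTheory Metric Set Complex Finset
open scoped BigOperators Function
open Summit.QuantumFields.BalabanUV.T4Continuum.B13TermContours
open Literature.MathematicalPhysics.QuantumFieldTheory.Balaban1983to89.B13Resummation (locE)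
open Literature.Probability.LatticeModels (polyInc)
open Summit.QuantumFields.BalabanUV.T4Continuum.NE1p.DressedSmallFieldShape (muPart_locE_le_of_linearDressing)
open Summit.QuantumFields.BalabanUV.T4Continuum.NE1p.DressedSmallFieldPencilWitness
  (Pol cubes₂ d₂ hloc₂ hd₂ h126₂ hvol₂ h227₂ hsmall₂ envelope₂_eq)
open Summit.QuantumFields.BalabanUV.T4Continuum.NE1p.DressedSmallFieldInductionWitness (exp_locE_univ)
open Summit.QuantumFields.BalabanUV.T4Continuum.NE1p.DressedSmallFieldContourWitness
  (linC majorant_C_le cauchyLetter_rep ev ev_apply oR V₀M OM oR_mem norm_V₀M_le norm_OM_le)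
open Summit.QuantumFields.BalabanUV.T4Continuum.NE1p.DressedSmallFieldCubeLetterWitness
  (one_lt_rexp μc νK cK cK_pos linK hlinw_K hl_K card_cubes₂)
open Summit.QuantumFields.BalabanUV.T4Continuum.NE1p.DressedSmallFieldMixedLetter
open DressedSmallFieldPencilWitness.Pol

/-! ## §3 ONE (2.14)-SHAPE TERM PER POLYMER OF W23's TWO-CUBE CATALOGUE WITH A JOINT FACTOR: N0k's END fires with `hL3` DERIVED -/

variable {F : Pol → (Fin 2 → ℂ) → ℂ} {κ₁ : ℝ}

/-- The (1.22)-radii: every cube on the circle `|σ(Δ)| = e^{κ₁}`. -/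
abbrev rK (κ₁ : ℝ) : Fin 2 → ℝ := fun _ => Real.exp κ₁

/-- [folklore] W34's coordinate measures ARE §2's active-set measures of the cubes of `Z` (`rfl`) — the term measure is W34's `νK Z` BY NAME. -/
theorem μc_eq_μS (Z : Pol) : μc Z = μS (cubes₂ Z) := rfl

/-- THE PREFACTOR of polymer `Z`'s term: `cK·(Π_{Δ∈cubes₂ Z} w₁(e^{κ₁})(p Δ))·F Z(σ_{cubes₂ Z}(p))·w₁ 2 q` — the JOINT factor `F Z` of all the
cube variables of `Z` AT the contour configuration; W34's d-free `cK`, Mayer weight `w₁ 2` as there. -/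
def preF (F : Pol → (Fin 2 → ℂ) → ℂ) (κ₁ : ℝ) (Z : Pol) (ω : (Fin 2 → ℝ × ℝ) × (ℝ × ℝ)) : ℂ :=
  (cK : ℂ) * (wS (rK κ₁) (cubes₂ Z) ω.1 * F Z (σS (rK κ₁) (cubes₂ Z) ω.1)) * w₁ 2 ω.2

/-- THE ACTIVITY IN CLOSED FORM, RADIUS-FREE: `actF F s Z := cK·Δ_{cubes₂ Z}(F Z)·(e^{(V₀M + s•OM) Z} − 1)` — the MIXED decoupling difference of
the joint factor through the cubes of `Z` times the Mayer factor of the dressed table entry. -/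
def actF (F : Pol → (Fin 2 → ℂ) → ℂ) (s : ℂ) (Z : Pol) : ℂ :=
  (cK : ℂ) * mixedDiff 2 (cubes₂ Z) (F Z) * (cexp ((V₀M + s • OM) Z) - 1)

/-- [folklore] A bound by `1` on the closed POLYDISC (print's (1.18)∕(1.21) on the analyticity domain `|s(Δ)| ≤ e^{κ₁}`, TYPE) bounds the
factor at every contour configuration. -/
theorem hB_σS (hB : ∀ Z σ, (∀ Δ, ‖σ Δ‖ ≤ Real.exp κ₁) → ‖F Z σ‖ ≤ 1) (Z : Pol) (S : Finset (Fin 2)) (p : Fin 2 → ℝ × ℝ) :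
    ‖F Z (σS (rK κ₁) S p)‖ ≤ 1 :=
  hB Z _ fun Δ => norm_σS_le (fun _ => (Real.exp_pos κ₁).le) S p Δ

/-- Socket `hpre` of N0k. [folklore] -/
theorem hpre_F (hF : ∀ Z, Differentiable ℂ (F Z)) (Z : Pol) : AEStronglyMeasurable (preF F κ₁ Z) (νK Z) :=
  ((measurable_const.mul (((measurable_wS _ _).comp measurable_fst).mul
    ((hF Z).continuous.measurable.comp ((measurable_σS _ _).comp measurable_fst)))).mul
    ((measurable_w₁ 2).comp measurable_snd)).aestronglyMeasurable

/-- **(B1) `hrep` FOR THE JOINT-FACTOR TERM IS A THEOREM, AT EVERY RADIUS** (kernel; Fubini `integral_prod_mul` × §2 `mixedLetter_rep` on the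
cube block × W29 `cauchyLetter_rep` on the polymer letter): for every `κ₁ > 0`, every family of jointly entire factors and every source `s`,
`actF F s Z = Σ_{j∈{Z}} ∫ preF_j(ω)·exp(ℓ_{j,ω}(V₀M + s•OM)) dνK_j(ω)`. -/
theorem hrep_F (hκ : 0 < κ₁) (hF : ∀ Z, Differentiable ℂ (F Z)) (s : ℂ) (Z : Pol) :
    actF F s Z = ∑ j ∈ ({Z} : Finset Pol), ∫ ω, preF F κ₁ j ω * cexp (linK j ω (V₀M + s • OM)) ∂(νK j) := by
  rw [Finset.sum_singleton]
  have h1 : ∀ ω : (Fin 2 → ℝ × ℝ) × (ℝ × ℝ), preF F κ₁ Z ω * cexp (linK Z ω (V₀M + s • OM)) =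
      ((cK : ℂ) * (wS (rK κ₁) (cubes₂ Z) ω.1 * F Z (σS (rK κ₁) (cubes₂ Z) ω.1))) *
        (w₁ 2 ω.2 * cexp (linC 2 (ev Z) ω.2 (V₀M + s • OM))) := fun ω => by
    simp only [preF, linK]; ring
  simp_rw [h1]
  rw [νK, integral_prod_mul (f := fun p : Fin 2 → ℝ × ℝ => (cK : ℂ) * (wS (rK κ₁) (cubes₂ Z) p * F Z (σS (rK κ₁) (cubes₂ Z) p)))
    (g := fun q : ℝ × ℝ => w₁ 2 q * cexp (linC 2 (ev Z) q (V₀M + s • OM))), cauchyLetter_rep one_lt_two, ev_apply,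
    integral_const_mul, μc_eq_μS, mixedLetter_rep 2 (rK κ₁) (cubes₂ Z) (F Z) (fun _ => one_lt_rexp hκ) (hF Z), actF]

/-- [folklore] Pointwise size of the prefactor under the polydisc bound: `‖preF‖ ≤ cK·(max (wB₁ e^{κ₁}) 1)²·wB₁ 2`. -/
theorem norm_preF_le (hκ : 0 < κ₁) (hB : ∀ Z σ, (∀ Δ, ‖σ Δ‖ ≤ Real.exp κ₁) → ‖F Z σ‖ ≤ 1) (Z : Pol)
    (ω : (Fin 2 → ℝ × ℝ) × (ℝ × ℝ)) : ‖preF F κ₁ Z ω‖ ≤ cK * (max (wB₁ (Real.exp κ₁)) 1) ^ 2 * wB₁ 2 := by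
  rw [preF, norm_mul, norm_mul, norm_mul, Complex.norm_real, Real.norm_of_nonneg cK_pos.le]
  have h0 : (0 : ℝ) ≤ max (wB₁ (Real.exp κ₁)) 1 := zero_le_one.trans (le_max_right _ _)
  have h1 : ‖wS (rK κ₁) (cubes₂ Z) ω.1‖ ≤ (max (wB₁ (Real.exp κ₁)) 1) ^ 2 :=
    (norm_wS_le (fun _ => one_lt_rexp hκ) _ _).trans_eq (by rw [Finset.prod_const, Finset.card_univ, Fintype.card_fin])
  exact mul_le_mul (mul_le_mul_of_nonneg_left ((mul_le_mul h1 (hB_σS hB Z _ _) (norm_nonneg _) (pow_nonneg h0 2)).trans_eq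
    (mul_one _)) cK_pos.le) (norm_w₁_le one_lt_two _) (norm_nonneg _) (mul_nonneg cK_pos.le (pow_nonneg h0 2))

/-- Socket `hint` of N0k at ANY exponent. [folklore] -/
theorem hint_F (hκ : 0 < κ₁) (hF : ∀ Z, Differentiable ℂ (F Z)) (hB : ∀ Z σ, (∀ Δ, ‖σ Δ‖ ≤ Real.exp κ₁) → ‖F Z σ‖ ≤ 1)
    (Z : Pol) (κ : ℝ) : Integrable (fun ω => ‖preF F κ₁ Z ω‖ * Real.exp κ) (νK Z) :=
  Integrable.mono' (integrable_const (cK * (max (wB₁ (Real.exp κ₁)) 1) ^ 2 * wB₁ 2 * Real.exp κ))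
    ((hpre_F hF Z).norm.mul aestronglyMeasurable_const)
    (Filter.Eventually.of_forall fun ω => by
      rw [Real.norm_of_nonneg (by positivity)]
      exact mul_le_mul_of_nonneg_right (norm_preF_le hκ hB Z ω) (Real.exp_pos κ).le)

/-- **(B3) — `hL3` DERIVED FOR EVERY JOINTLY ENTIRE FACTOR BOUNDED BY 1 ON THE POLYDISC** (kernel; §2 `mixedLetter_decay_le` on the cube block,
W34 `card_cubes₂`, the polymer letter `2e^{1∕2}`, `cK·2e^{1∕2} = 1∕12`): for every `κ₁ ≥ 1`,
`Σ_{j∈{Z}} ∫ ‖preF_j‖·e^{1∕2} dνK_j ≤ (1∕12)·e^{−(κ₁ − 1)·d₂ Z}` — the decay rate `R = κ₁ − 1` read off the contour radius, product structure or not. -/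
theorem hL3_F (hκ : 1 ≤ κ₁) (hB : ∀ Z σ, (∀ Δ, ‖σ Δ‖ ≤ Real.exp κ₁) → ‖F Z σ‖ ≤ 1) :
    ∀ Z : Pol, cubes₂ Z ⊆ univ →
      ∑ j ∈ ({Z} : Finset Pol), ∫ ω, ‖preF F κ₁ j ω‖ * Real.exp (2 * (1 / 8 + 1 * (1 / 8))) ∂(νK j) ≤
        1 / 12 * Real.exp (-((κ₁ - 1) * d₂ Z)) := by
  intro Z _
  rw [Finset.sum_singleton]
  have hhalf : (2 : ℝ) * (1 / 8 + 1 * (1 / 8)) = 1 / 2 := by norm_num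
  have h1 : ∀ ω : (Fin 2 → ℝ × ℝ) × (ℝ × ℝ), ‖preF F κ₁ Z ω‖ * Real.exp (2 * (1 / 8 + 1 * (1 / 8))) =
      (cK * ‖wS (rK κ₁) (cubes₂ Z) ω.1 * F Z (σS (rK κ₁) (cubes₂ Z) ω.1)‖) * (‖w₁ 2 ω.2‖ * Real.exp (1 / 2)) := fun ω => by
    rw [hhalf, preF, norm_mul, norm_mul, Complex.norm_real, Real.norm_of_nonneg cK_pos.le]; ring
  simp_rw [h1]
  rw [νK, integral_prod_mul (f := fun p : Fin 2 → ℝ × ℝ => cK * ‖wS (rK κ₁) (cubes₂ Z) p * F Z (σS (rK κ₁) (cubes₂ Z) p)‖)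
    (g := fun q : ℝ × ℝ => ‖w₁ 2 q‖ * Real.exp (1 / 2)), integral_const_mul, μc_eq_μS]
  have hcubes : ∫ p, ‖wS (rK κ₁) (cubes₂ Z) p * F Z (σS (rK κ₁) (cubes₂ Z) p)‖ ∂(Measure.pi (μS (cubes₂ Z))) ≤
      Real.exp (-((κ₁ - 1) * d₂ Z)) := by
    refine (mixedLetter_decay_le hκ (cubes₂ Z) (B := 1) fun p => hB_σS hB Z _ p).trans ?_
    rw [mul_one, card_cubes₂]
    exact Real.exp_le_exp.2 (by nlinarith [hd₂ Z])
  have hpoly : ∫ q, ‖w₁ 2 q‖ * Real.exp (1 / 2) ∂lam₁ ≤ 2 * Real.exp (1 / 2) := by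
    have h := majorant_C_le one_lt_two (1 / 2); norm_num at h; exact h
  calc cK * (∫ p, ‖wS (rK κ₁) (cubes₂ Z) p * F Z (σS (rK κ₁) (cubes₂ Z) p)‖ ∂(Measure.pi (μS (cubes₂ Z)))) *
        ∫ q, ‖w₁ 2 q‖ * Real.exp (1 / 2) ∂lam₁ ≤ cK * Real.exp (-((κ₁ - 1) * d₂ Z)) * (2 * Real.exp (1 / 2)) :=
        mul_le_mul (mul_le_mul_of_nonneg_left hcubes cK_pos.le) hpoly (integral_nonneg fun _ => by positivity)
          (mul_nonneg cK_pos.le (Real.exp_pos _).le)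
    _ = 1 / 12 * Real.exp (-((κ₁ - 1) * d₂ Z)) := by
        have : Real.exp (1 / 2 : ℝ) ≠ 0 := (Real.exp_pos _).ne'
        simp only [cK]; field_simp; ring

/-- **N0k's END FIRES WITH THE DECAY EARNED BY THE MIXED LETTER** (ONE application BY NAME; W23's sockets, W29's table norms, W34's `hlinw_K`∕`hl_K` BY
NAME; `hrep := hrep_F`, `hL3 := hL3_F` THEOREMS): for every `κ₁ ≥ 6` (`hrate : 1 + 2·1 + 2 ≤ κ₁ − 1`, as located in W34) and every family `F` of
JOINTLY entire factors bounded by `1` on the closed polydisc, `‖E_μ(univ) − E_0(univ)‖ ≤ e·1·1·(3∕2)²·(1∕12)·e^{−1·1}·μ₀∕(1 − μ₀)`. -/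
theorem muPart_fires_F (hκ : 6 ≤ κ₁) (hF : ∀ Z, Differentiable ℂ (F Z)) (hB : ∀ Z σ, (∀ Δ, ‖σ Δ‖ ≤ Real.exp κ₁) → ‖F Z σ‖ ≤ 1)
    {μ₀ : ℝ} {μ : ℂ} (h0 : 0 < μ₀) (h01 : μ₀ < 1) (hμ : ‖μ‖ ≤ μ₀) :
    ‖locE (polyInc on cubes₂) cubes₂ (actF F μ) univ - locE (polyInc on cubes₂) cubes₂ (actF F 0) univ‖ ≤
      Real.exp 1 * 1 * 1 * (3 / 2) ^ 2 * (1 / 12) * Real.exp (-(1 * 1)) * (μ₀ / (1 - μ₀)) :=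
  muPart_locE_le_of_linearDressing (polyInc on cubes₂) (reach := cubes₂) (d := d₂) (ν' := νK) (pre := preF F κ₁)
    (lin := linK) (l := fun _ _ => 2) (V₀ := V₀M) (O := OM) (terms := fun Z => {Z}) (act := actF F) (A := 1 / 12)
    (R := κ₁ - 1) (r₁ := 1) (κ₀ := 1) (K₀ := 3 / 2) (c₁ := 1) (c := 1) (b := 1) (ν := 1) (dX := 1) (μ₁ := 1) (ε₁ := 1 / 8)
    (b₀ := 1 / 8) hloc₂ (fun Z => by rw [one_mul]) hd₂ (by norm_num) (by norm_num) (by norm_num) (by norm_num) (by norm_num)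
    (by norm_num) (by norm_num) (by norm_num) h126₂ hvol₂ h227₂ (by linarith) hsmall₂ univ_nonempty
    (fun s _ Z => hrep_F (by linarith) hF s Z) (hpre_F hF) hlinw_K hl_K (fun Z => hint_F (by linarith) hF hB Z _)
    norm_V₀M_le norm_OM_le (by norm_num) (hL3_F (by linarith) hB) h0 h01 hμ

/-- The same END in closed numerals (W23 `envelope₂_eq`): `‖E_μ(univ) − E_0(univ)‖ ≤ (3∕16)·μ₀∕(1 − μ₀)`. -/
theorem muPart_fires_F' (hκ : 6 ≤ κ₁) (hF : ∀ Z, Differentiable ℂ (F Z)) (hB : ∀ Z σ, (∀ Δ, ‖σ Δ‖ ≤ Real.exp κ₁) → ‖F Z σ‖ ≤ 1)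
    {μ₀ : ℝ} {μ : ℂ} (h0 : 0 < μ₀) (h01 : μ₀ < 1) (hμ : ‖μ‖ ≤ μ₀) :
    ‖locE (polyInc on cubes₂) cubes₂ (actF F μ) univ - locE (polyInc on cubes₂) cubes₂ (actF F 0) univ‖ ≤ 3 / 16 * (μ₀ / (1 - μ₀)) := by
  rw [← envelope₂_eq]; exact muPart_fires_F hκ hF hB h0 h01 hμ

/-! ## §4 GENUINE on a DECIDED NON-PRODUCT joint factor: `hB` TIGHT, not a product of cube factors, the μ-part moves -/

/-- THE DECIDED JOINT FACTOR `Fj κ₁ Z σ := (1 + e^{−κ₁·#cubes₂ Z}·Π_{Δ∈cubes₂ Z} σ Δ)∕2` — a coupling THROUGH ALL the cubes of `Z` at once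
(on the pair polymer: `(1 + e^{−2κ₁}σ₀σ₁)∕2`, genuinely mixed). -/
def Fj (κ₁ : ℝ) (Z : Pol) (σ : Fin 2 → ℂ) : ℂ := (1 + (Real.exp (-(κ₁ * (cubes₂ Z).card)) : ℂ) * ∏ Δ ∈ cubes₂ Z, σ Δ) / 2

/-- [folklore] The coupling monomial through the cubes of `Z` is entire. -/
theorem differentiable_cpl : ∀ Z : Pol, Differentiable ℂ fun σ : Fin 2 → ℂ => ∏ Δ ∈ cubes₂ Z, σ Δ
  | p0 => by simpa [cubes₂] using differentiable_apply (𝕜 := ℂ) (0 : Fin 2)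
  | p1 => by simpa [cubes₂] using differentiable_apply (𝕜 := ℂ) (1 : Fin 2)
  | p01 => by
      simp only [cubes₂, Finset.prod_pair (show (0 : Fin 2) ≠ 1 by decide)]
      exact (differentiable_apply (𝕜 := ℂ) (0 : Fin 2)).mul (differentiable_apply (𝕜 := ℂ) 1)

/-- Admissibility `hF`: the decided factor is jointly entire. [folklore] -/
theorem differentiable_Fj (κ₁ : ℝ) (Z : Pol) : Differentiable ℂ (Fj κ₁ Z) := by
  have e : Fj κ₁ Z = fun σ => (1 + (Real.exp (-(κ₁ * (cubes₂ Z).card)) : ℂ) * ∏ Δ ∈ cubes₂ Z, σ Δ) * (2 : ℂ)⁻¹ := by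
    funext σ; rw [Fj, div_eq_mul_inv]
  rw [e]
  exact (((differentiable_cpl Z).const_mul (Real.exp (-(κ₁ * (cubes₂ Z).card)) : ℂ)).const_add (1 : ℂ)).mul_const _

/-- **Admissibility `hB`: `‖Fj‖ ≤ 1` ON THE CLOSED POLYDISC `|σ(Δ)| ≤ e^{κ₁}`.** [folklore] -/
theorem norm_Fj_le (κ₁ : ℝ) (Z : Pol) {σ : Fin 2 → ℂ} (hσ : ∀ Δ, ‖σ Δ‖ ≤ Real.exp κ₁) : ‖Fj κ₁ Z σ‖ ≤ 1 := by
  have hp : ‖∏ Δ ∈ cubes₂ Z, σ Δ‖ ≤ Real.exp (κ₁ * (cubes₂ Z).card) := by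
    rw [norm_prod]
    calc ∏ Δ ∈ cubes₂ Z, ‖σ Δ‖ ≤ ∏ _Δ ∈ cubes₂ Z, Real.exp κ₁ := Finset.prod_le_prod (fun _ _ => norm_nonneg _) fun Δ _ => hσ Δ
      _ = Real.exp (κ₁ * (cubes₂ Z).card) := by rw [Finset.prod_const, ← Real.exp_nat_mul]; ring_nf
  have h1 : ‖(1 : ℂ) + (Real.exp (-(κ₁ * (cubes₂ Z).card)) : ℂ) * ∏ Δ ∈ cubes₂ Z, σ Δ‖ ≤ 2 := by
    refine (norm_add_le _ _).trans ?_
    rw [norm_one, norm_mul, Complex.norm_real, Real.norm_of_nonneg (Real.exp_pos _).le]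
    have : Real.exp (-(κ₁ * (cubes₂ Z).card)) * ‖∏ Δ ∈ cubes₂ Z, σ Δ‖ ≤ 1 :=
      (mul_le_mul_of_nonneg_left hp (Real.exp_pos _).le).trans_eq (by rw [← Real.exp_add, neg_add_cancel, Real.exp_zero])
    linarith
  rw [Fj, norm_div, show ‖(2 : ℂ)‖ = 2 by simp, div_le_one (by norm_num)]
  exact h1

/-- **… AND ATTAINED** on the polydisc's distinguished boundary point `σ ≡ e^{κ₁}`: `Fj = 1` — `hB` is TIGHT. [folklore] -/
theorem Fj_diag (κ₁ : ℝ) (Z : Pol) : Fj κ₁ Z (fun _ => (Real.exp κ₁ : ℂ)) = 1 := by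
  have h : (Real.exp (-(κ₁ * (cubes₂ Z).card)) : ℂ) * ∏ _Δ ∈ cubes₂ Z, (Real.exp κ₁ : ℂ) = 1 := by
    rw [Finset.prod_const, ← Complex.ofReal_pow, ← Complex.ofReal_mul, ← Real.exp_nat_mul, ← Real.exp_add,
      show -(κ₁ * ((cubes₂ Z).card : ℝ)) + ((cubes₂ Z).card : ℝ) * κ₁ = 0 by ring, Real.exp_zero, Complex.ofReal_one]
  rw [Fj, h]; norm_num

/-- Admissibility `hB` of the decided factor, in N0k's form. [folklore] -/
theorem hB_Fj (κ₁ : ℝ) : ∀ (Z : Pol) (σ : Fin 2 → ℂ), (∀ Δ, ‖σ Δ‖ ≤ Real.exp κ₁) → ‖Fj κ₁ Z σ‖ ≤ 1 :=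
  fun Z _ hσ => norm_Fj_le κ₁ Z hσ

/-- **THE PAIR POLYMER'S FACTOR IS NOT A PRODUCT OF CUBE FACTORS** — W34's class (`Π_Δ G Δ(σ_Δ)`) does not contain it: the four corner values
`F(0,0) = F(0,1) = F(1,0) = 1∕2`, `F(1,1) = (1 + e^{−2κ₁})∕2` violate `F(0,0)·F(1,1) = F(0,1)·F(1,0)`. -/
theorem Fj_not_product (κ₁ : ℝ) : ¬ ∃ g h : ℂ → ℂ, ∀ σ : Fin 2 → ℂ, Fj κ₁ p01 σ = g (σ 0) * h (σ 1) := by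
  rintro ⟨g, h, hgh⟩
  have hc0 : (Real.exp (-(κ₁ * (({0, 1} : Finset (Fin 2)).card : ℝ))) : ℂ) ≠ 0 :=
    Complex.ofReal_ne_zero.2 (Real.exp_pos _).ne'
  have e00 := hgh ![0, 0]
  have e01 := hgh ![0, 1]
  have e10 := hgh ![1, 0]
  have e11 := hgh ![1, 1]
  simp only [Fj, cubes₂, Finset.prod_pair (show (0 : Fin 2) ≠ 1 by decide), Matrix.cons_val_zero, Matrix.cons_val_one,
    mul_zero, mul_one, add_zero] at e00 e01 e10 e11
  exact hc0 (by linear_combination 2 * e11 + (4 * (g 1 * h 1)) * e00 - (4 * (g 1 * h 0)) * e01 - 2 * e10)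

/-- **THE MIXED LETTER OF THE DECIDED FACTOR**: `Δ_{cubes₂ Z} (Fj κ₁ Z) = e^{−κ₁·#cubes₂ Z}∕2` — on the pair polymer a GENUINELY mixed second
difference (`F(1,1) − F(1,0) − F(0,1) + F(0,0)`), reproduced by §2's iterated letters at every radius. -/
theorem mixedDiff_Fj (κ₁ : ℝ) : ∀ Z : Pol, mixedDiff 2 (cubes₂ Z) (Fj κ₁ Z) = (Real.exp (-(κ₁ * (cubes₂ Z).card)) : ℂ) / 2
  | p0 => by rw [show cubes₂ p0 = {0} from rfl, mixedDiff_zero]; simp [Fj, cubes₂]; ring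
  | p1 => by rw [show cubes₂ p1 = {1} from rfl, mixedDiff_one]; simp [Fj, cubes₂]; ring
  | p01 => by rw [show cubes₂ p01 = {0, 1} from rfl, mixedDiff_pair]; simp [Fj, cubes₂]; ring

/-- **THE END ON THE DECIDED FACTOR, in closed numerals**: for every `κ₁ ≥ 6`, `‖E_μ(univ) − E_0(univ)‖ ≤ (3∕16)·μ₀∕(1 − μ₀)`. -/
theorem muPart_fires_Fj (hκ : 6 ≤ κ₁) {μ₀ : ℝ} {μ : ℂ} (h0 : 0 < μ₀) (h01 : μ₀ < 1) (hμ : ‖μ‖ ≤ μ₀) :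
    ‖locE (polyInc on cubes₂) cubes₂ (actF (Fj κ₁) μ) univ -
        locE (polyInc on cubes₂) cubes₂ (actF (Fj κ₁) 0) univ‖ ≤ 3 / 16 * (μ₀ / (1 - μ₀)) :=
  muPart_fires_F' hκ (differentiable_Fj κ₁) (hB_Fj κ₁) h0 h01 hμ

/-- The activity on the decided factor at a REAL source, as a real number. -/
def vF (κ₁ μ : ℝ) (Z : Pol) : ℝ := cK * (Real.exp (-(κ₁ * (cubes₂ Z).card)) / 2) * (Real.exp (1 / 8 + μ * oR Z) - 1)

/-- [folklore] At a real source the activity on the decided factor is the real number `vF κ₁ μ Z`. -/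
theorem actF_Fj_ofReal (κ₁ μ : ℝ) : actF (Fj κ₁) (μ : ℂ) = fun Z => ((vF κ₁ μ Z : ℝ) : ℂ) := by
  funext Z
  simp only [actF, mixedDiff_Fj, vF, V₀M, OM, Pi.add_apply, Pi.smul_apply, smul_eq_mul]
  push_cast
  ring

/-- [folklore] `0 ≤ vF κ₁ μ Z` for `0 ≤ μ`. -/
theorem vF_nonneg (κ₁ : ℝ) {μ : ℝ} (hμ : 0 ≤ μ) (Z : Pol) : 0 ≤ vF κ₁ μ Z :=
  mul_nonneg (mul_nonneg cK_pos.le (by positivity))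
    (by have := (oR_mem Z).1; linarith [Real.add_one_le_exp (1 / 8 + μ * oR Z), mul_nonneg hμ this])

/-- [folklore] The coefficient of the pair polymer's Mayer factor is not zero. -/
theorem coeffF_p01_ne_zero (κ₁ : ℝ) : cK * (Real.exp (-(κ₁ * (cubes₂ p01).card)) / 2) ≠ 0 :=
  mul_ne_zero cK_pos.ne' (by positivity)

/-- **THE μ-PART IS NOT ZERO ON THE DECIDED JOINT FACTOR** (END level; W25 `exp_locE_univ` BY NAME): for a real source `0 < μ` the small-field
output at `univ` MOVES — §3 bounds a NON-ZERO quantity. -/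
theorem locE_live_Fj (κ₁ : ℝ) {μ : ℝ} (hμ : 0 < μ) :
    locE (polyInc on cubes₂) cubes₂ (actF (Fj κ₁) μ) univ ≠ locE (polyInc on cubes₂) cubes₂ (actF (Fj κ₁) 0) univ := by
  intro h
  have h' := congrArg Complex.exp h
  rw [← Complex.ofReal_zero, actF_Fj_ofReal κ₁ μ, actF_Fj_ofReal κ₁ 0, exp_locE_univ (vF_nonneg κ₁ hμ.le),
    exp_locE_univ (vF_nonneg κ₁ le_rfl), Complex.ofReal_inj] at h'
  have ha0 : vF κ₁ μ p0 = vF κ₁ 0 p0 := by simp [vF, oR]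
  have ha1 : vF κ₁ μ p1 = vF κ₁ 0 p1 := by simp [vF, oR]
  rw [ha0, ha1] at h'
  have hpos : 0 < (1 + vF κ₁ 0 p0) * (1 + vF κ₁ 0 p1) := by
    have := vF_nonneg κ₁ le_rfl p0; have := vF_nonneg κ₁ le_rfl p1; positivity
  rw [div_left_inj' hpos.ne', add_right_inj] at h'
  have h2 : Real.exp (1 / 8 + μ * oR p01) = Real.exp (1 / 8 + 0 * oR p01) := by
    have := mul_left_cancel₀ (coeffF_p01_ne_zero κ₁) h'; linarith
  rw [Real.exp_eq_exp] at h2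
  norm_num [oR] at h2
  exact hμ.ne' h2

end Summit.QuantumFields.BalabanUV.T4Continuum.NE1p.DressedSmallFieldMixedLetterWitness

end
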